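import Literature.NumberTheory.Transcendental.ThetaBaseLowerBound
import Literature.NumberTheory.Transcendental.BakerFieldG
import Mathlib.Algebra.Module.ZLattice.Basic
import HarnessLib

/-!
# A lower bound for the base theta function at the points `s·v` of a general algebraic point

Topic: `Literature/NumberTheory/Transcendental`. Unit
`provefact-Literature.NumberTheory.Transcendental.s-efcbe22610` (fact `semistabilityTheorem_std`).
The arithmetic step of Baker's method compares `φ_{x,k}(s) = Θ_{J₀}(s·v)^D · (algebraic number)`
with a Liouville bound and needs a LOWER bound for the base theta function
`Θ_{J₀(c_s)}(s·v) = ∏_b P_{i_b}(s z_b)` at the points `s·v`. `ThetaBaseLowerBound.lean` proves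
it when the `E`-coordinates are torsion. Here we prove it for the reduced general points of
`BakerFieldG.lean` (each `z_b` a lattice vector, or without torsion), where for a non-torsion
coordinate `P₀(s z_b) = σ(s z_b)³` and the issue is how close `s z_b` can come to the lattice —
Baker–Wüstholz's "`log max |f_i(sv)| ≫ −(s²+1)‖v‖²`" (p. 119), obtained here from heights:

* `PeriodPair.exists_weierstrassP_norm_ge_near_lattice` — `‖℘(u)‖ ≥ ‖u − λ‖⁻² − C₀` for
  `0 < ‖u − λ‖ ≤ r₀`, `λ ∈ Λ` (`℘ − (u−λ)⁻²` is analytic at `λ`, Mathlib's `weierstrassPExcept`);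
* `PeriodPair.exists_norm_weierstrassSigma_ge` — **`‖σ(u)‖ ≥ c·ε·e^{−C(1+‖u‖²)}` whenever
  `0 < ε ≤ r₁` and `u` has distance `≥ ε` from `Λ`** (reduction to a fundamental parallelogram
  with Mathlib's `ZSpan.fract`, the automorphy of `σ` under `Λ` (`SigmaLatticeAutomorphy.lean`),
  compactness away from the lattice, and `σ(w) = w + o(w)` at `0`);
* `BakerDataG.dist_lattice_ge` — for a non-torsion coordinate and `s ≥ 1`,
  `‖s z_b − λ‖ ≥ min(r₀, 1)/(gBound s + C₀)` for all `λ ∈ Λ`: otherwise `‖℘(s z_b)‖` would exceed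
  the conjugate bound `gBound s` of `BakerFieldG.lean` (heights!);
* `BakerDataG.exists_theta_baseIdx_ge` — **there are `c > 0`, `C ≥ 0` with
  `c · e^{−C(s+1)³} ≤ ‖Θ_{J₀(c_s)}(s·v)‖` for all `s ∈ ℕ`** (cubic, from `gBound s = Mg^{(s+1)³}`;
  lattice coordinates contribute `|P₂(sλ)| = 2e^{3s²·Re(η(λ)λ/2)}`).

## References

* A. Baker, G. Wüstholz, *Logarithmic Forms and Diophantine Geometry*, CUP 2007, §6.8 (p. 119).
* E. T. Whittaker, G. N. Watson, *A Course of Modern Analysis*, §20.421.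
-/

noncomputable section

open Complex Filter Metric Set
open scoped PeriodPair Topology

namespace Literature.NumberTheory.Transcendental

variable (L : PeriodPair)

/-! ### `℘` near the lattice -/

/-- **`℘` is large near the lattice**: there are `r₀ > 0` and `C₀ ≥ 0` with
`‖u − λ‖⁻² − C₀ ≤ ‖℘(u)‖` whenever `λ ∈ Λ` and `0 < ‖u − λ‖ ≤ r₀` (the function
`℘(w) − w⁻²` is analytic, hence bounded, near `0`; then periodicity). [folklore] -/
theorem _root_.PeriodPair.exists_weierstrassP_norm_ge_near_lattice :
    ∃ r₀ : ℝ, 0 < r₀ ∧ ∃ C₀ : ℝ, 0 ≤ C₀ ∧ ∀ lam ∈ L.lattice, ∀ u : ℂ,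
      0 < ‖u - lam‖ → ‖u - lam‖ ≤ r₀ → (‖u - lam‖ ^ 2)⁻¹ - C₀ ≤ ‖℘[L] u‖ := by
  -- `f = ℘[L - 0]` is continuous at `0`, hence bounded near `0`
  have hcont : ContinuousAt (L.weierstrassPExcept 0) 0 := (L.analyticAt_weierstrassPExcept 0).continuousAt
  obtain ⟨r, hr, hball⟩ : ∃ r > 0, ∀ w : ℂ, ‖w‖ < r → ‖L.weierstrassPExcept 0 w - L.weierstrassPExcept 0 0‖ < 1 := by
    have := Metric.continuousAt_iff.mp hcont 1 one_pos
    obtain ⟨r, hr, h⟩ := this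
    exact ⟨r, hr, fun w hw => by simpa [dist_eq_norm] using h (by simpa [dist_eq_norm] using hw)⟩
  set C₀ : ℝ := ‖L.weierstrassPExcept 0 0‖ + 1 with hC₀
  refine ⟨r / 2, by positivity, C₀, by positivity, fun lam hlam u hpos hle => ?_⟩
  set w : ℂ := u - lam with hw
  have hwr : ‖w‖ < r := lt_of_le_of_lt hle (by linarith)
  have hfw : ‖L.weierstrassPExcept 0 w‖ ≤ C₀ := by
    have := hball w hwr
    have h1 : ‖L.weierstrassPExcept 0 w‖ ≤ ‖L.weierstrassPExcept 0 w - L.weierstrassPExcept 0 0‖ +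
        ‖L.weierstrassPExcept 0 0‖ := norm_le_norm_sub_add _ _
    linarith
  -- `℘ u = ℘ w = f w + w⁻²`
  have hper : ℘[L] u = ℘[L] w := by
    rw [hw, show u - lam = u - ((⟨lam, hlam⟩ : L.lattice) : ℂ) from rfl, L.weierstrassP_sub_coe]
  have hdec : ℘[L] w = L.weierstrassPExcept 0 w + 1 / w ^ 2 := by
    have := L.weierstrassPExcept_add 0 w
    simp only [Submodule.coe_zero, sub_zero, ne_eq, OfNat.ofNat_ne_zero, not_false_eq_true, zero_pow,
      div_zero] at this
    rw [← this]
  rw [hper, hdec]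
  have hw0 : w ≠ 0 := norm_pos_iff.mp hpos
  have h3 : ‖(1 : ℂ) / w ^ 2‖ ≤ ‖L.weierstrassPExcept 0 w + 1 / w ^ 2‖ + ‖L.weierstrassPExcept 0 w‖ := by
    calc ‖(1 : ℂ) / w ^ 2‖ = ‖(L.weierstrassPExcept 0 w + 1 / w ^ 2) - L.weierstrassPExcept 0 w‖ := by
          congr 1; ring
      _ ≤ _ := norm_sub_le _ _
  have h4 : ‖(1 : ℂ) / w ^ 2‖ = (‖w‖ ^ 2)⁻¹ := by rw [norm_div, norm_one, norm_pow, one_div]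
  linarith

/-! ### The quasi-period map and reduction modulo the lattice -/

/-- The `ℝ`-linear extension `E : ℂ → ℂ` of the quasi-period map, `E(ω₁) = η₁`, `E(ω₂) = η₂`.
[folklore] -/
def _root_.PeriodPair.etaLin : ℂ →ₗ[ℝ] ℂ := L.basis.constr ℝ ![L.η₁, L.η₂]

/-- `E(mω₁ + nω₂) = mη₁ + nη₂`. [folklore] -/
theorem _root_.PeriodPair.etaLin_lattice (m n : ℤ) :
    L.etaLin (m * L.ω₁ + n * L.ω₂) = m * L.η₁ + n * L.η₂ := by
  have h0 : L.etaLin L.ω₁ = L.η₁ := by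
    have := L.basis.constr_basis ℝ ![L.η₁, L.η₂] 0
    simpa [PeriodPair.etaLin] using this
  have h1 : L.etaLin L.ω₂ = L.η₂ := by
    have := L.basis.constr_basis ℝ ![L.η₁, L.η₂] 1
    simpa [PeriodPair.etaLin] using this
  have em : (m : ℂ) * L.ω₁ = (m : ℝ) • L.ω₁ := by simp [Complex.real_smul]
  have en : (n : ℂ) * L.ω₂ = (n : ℝ) • L.ω₂ := by simp [Complex.real_smul]
  rw [em, en, map_add, map_smul, map_smul, h0, h1]
  simp [Complex.real_smul]

/-- **A bound for the quasi-periods**: `‖mη₁ + nη₂‖ ≤ C_η ‖mω₁ + nω₂‖`. [folklore] -/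
theorem _root_.PeriodPair.exists_norm_eta_le :
    ∃ Cη : ℝ, 0 ≤ Cη ∧ ∀ m n : ℤ, ‖(m * L.η₁ + n * L.η₂ : ℂ)‖ ≤ Cη * ‖(m * L.ω₁ + n * L.ω₂ : ℂ)‖ := by
  set E : ℂ →L[ℝ] ℂ := LinearMap.toContinuousLinearMap L.etaLin with hE
  refine ⟨‖E‖, norm_nonneg _, fun m n => ?_⟩
  have h := E.le_opNorm (m * L.ω₁ + n * L.ω₂)
  have e : E (m * L.ω₁ + n * L.ω₂) = m * L.η₁ + n * L.η₂ := by
    rw [hE, LinearMap.coe_toContinuousLinearMap']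
    exact L.etaLin_lattice m n
  rwa [e] at h

/-- **Reduction modulo the lattice**: every `u` is `w + λ` with `λ = mω₁ + nω₂ ∈ Λ` and
`‖w‖ ≤ ρ := ‖ω₁‖ + ‖ω₂‖` (`w = ZSpan.fract`). [folklore] -/
theorem _root_.PeriodPair.exists_reduce (u : ℂ) :
    ∃ m n : ℤ, ‖u - (m * L.ω₁ + n * L.ω₂)‖ ≤ ‖L.ω₁‖ + ‖L.ω₂‖ := by
  have hmem : (ZSpan.floor L.basis u : ℂ) ∈ L.lattice := by
    rw [L.lattice_eq_span_range_basis]; exact (ZSpan.floor L.basis u).2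
  obtain ⟨m, n, hmn⟩ := PeriodPair.mem_lattice.mp hmem
  refine ⟨m, n, ?_⟩
  have hf : ZSpan.fract L.basis u = u - (m * L.ω₁ + n * L.ω₂) := by
    rw [ZSpan.fract_apply, hmn]
  have hle := ZSpan.norm_fract_le L.basis u
  rw [hf] at hle
  simpa [Fin.sum_univ_two] using hle

/-! ### `σ` away from the lattice -/

/-- `σ(w) = w + o(w)`: there is `r₁ > 0` with `‖w‖/2 ≤ ‖σ(w)‖` for `‖w‖ ≤ r₁`. [folklore] -/
theorem _root_.PeriodPair.exists_norm_weierstrassSigma_ge_near_zero :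
    ∃ r₁ : ℝ, 0 < r₁ ∧ ∀ w : ℂ, ‖w‖ ≤ r₁ → ‖w‖ / 2 ≤ ‖L.weierstrassSigma w‖ := by
  have h := L.hasDerivAt_weierstrassSigma_zero
  rw [hasDerivAt_iff_isLittleO] at h
  have h' := h.def (by norm_num : (0 : ℝ) < 1 / 2)
  simp only [L.weierstrassSigma_zero, sub_zero, smul_eq_mul, mul_one] at h'
  obtain ⟨r, hr, hball⟩ := Metric.eventually_nhds_iff.mp h'
  refine ⟨r / 2, by positivity, fun w hw => ?_⟩
  have hwr : dist w 0 < r := by rw [dist_zero_right]; linarith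
  have := hball hwr
  have h1 : ‖w‖ ≤ ‖L.weierstrassSigma w‖ + ‖L.weierstrassSigma w - w‖ := by
    calc ‖w‖ = ‖L.weierstrassSigma w - (L.weierstrassSigma w - w)‖ := by congr 1; ring
      _ ≤ _ := norm_sub_le _ _
  linarith

/-- The automorphy estimate: if `u = w + (mω₁ + nω₂)` with `‖w‖ ≤ R` (`R ≥ 1`) then
`‖σ(u)‖ ≥ e^{−C(1+‖u‖²)} ‖σ(w)‖` with `C = C_η (1 + 9R²)`. [folklore] -/
theorem _root_.PeriodPair.norm_weierstrassSigma_ge_of_decomp {Cη : ℝ} (hCη0 : 0 ≤ Cη)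
    (hCη : ∀ m n : ℤ, ‖(m * L.η₁ + n * L.η₂ : ℂ)‖ ≤ Cη * ‖(m * L.ω₁ + n * L.ω₂ : ℂ)‖)
    {R : ℝ} (hR : 1 ≤ R) {u w : ℂ} {m n : ℤ} (hu : u = w + (m * L.ω₁ + n * L.ω₂)) (hw : ‖w‖ ≤ R) :
    Real.exp (-(Cη * (1 + 9 * R ^ 2) * (1 + ‖u‖ ^ 2))) * ‖L.weierstrassSigma w‖ ≤ ‖L.weierstrassSigma u‖ := by
  set lam : ℂ := m * L.ω₁ + n * L.ω₂ with hlam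
  have hσu : L.weierstrassSigma u = L.sigmaLatticeAut m n w * L.weierstrassSigma w := by
    rw [hu]; exact L.weierstrassSigma_add_lattice m n w
  rw [hσu, norm_mul]
  refine mul_le_mul_of_nonneg_right ?_ (norm_nonneg _)
  refine le_trans (Real.exp_le_exp.mpr ?_) (L.norm_sigmaLatticeAut_ge m n w)
  rw [neg_le_neg_iff]
  have hlamle : ‖lam‖ ≤ ‖u‖ + R := by
    have : lam = u - w := by rw [hu]; ring
    rw [this]
    exact (norm_sub_le _ _).trans (by linarith)
  have hη := hCη m n
  have ha : 0 ≤ ‖u‖ := norm_nonneg u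
  have hl0 : 0 ≤ ‖lam‖ := norm_nonneg _
  calc ‖(m * L.η₁ + n * L.η₂ : ℂ)‖ * (‖w‖ + ‖(m * L.ω₁ + n * L.ω₂ : ℂ)‖ / 2)
      ≤ Cη * ‖lam‖ * (R + ‖lam‖ / 2) := by
        rw [← hlam]
        exact mul_le_mul hη (by linarith) (by positivity) (by positivity)
    _ ≤ Cη * ((‖u‖ + R) * (R + (‖u‖ + R) / 2)) := by
        rw [mul_assoc]
        refine mul_le_mul_of_nonneg_left ?_ hCη0
        exact mul_le_mul hlamle (by linarith) (by positivity) (by positivity)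
    _ ≤ Cη * (1 + 9 * R ^ 2) * (1 + ‖u‖ ^ 2) := by
        rw [mul_assoc]
        refine mul_le_mul_of_nonneg_left ?_ hCη0
        nlinarith [sq_nonneg (‖u‖ - 3 * R), sq_nonneg (‖u‖ - R), sq_nonneg R]

/-- **`σ` away from the lattice.** There are `c > 0`, `C ≥ 0` and `r₁ > 0` (depending only on
`Λ`) such that for every `u ∈ ℂ` and `0 < ε ≤ r₁` with `‖u − λ‖ ≥ ε` for all `λ ∈ Λ`:
`c · ε · e^{−C(1+‖u‖²)} ≤ ‖σ(u)‖`. Proof: write `u = w + λ` with `‖w‖ ≤ ‖ω₁‖ + ‖ω₂‖`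
(`ZSpan.fract`); if `w` is `r₁`-far from `Λ` it lies in a compact set on which `σ` is continuous
and non-zero; otherwise `u = w' + λ'` with `ε ≤ ‖w'‖ ≤ r₁` and `‖σ(w')‖ ≥ ‖w'‖/2`; in both cases the
automorphy factor is `≥ e^{−C(1+‖u‖²)}`. [folklore] -/
theorem _root_.PeriodPair.exists_norm_weierstrassSigma_ge :
    ∃ c : ℝ, 0 < c ∧ ∃ C : ℝ, 0 ≤ C ∧ ∃ r₁ : ℝ, 0 < r₁ ∧ ∀ (u : ℂ) (ε : ℝ), 0 < ε → ε ≤ r₁ →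
      (∀ lam ∈ L.lattice, ε ≤ ‖u - lam‖) →
      c * ε * Real.exp (-(C * (1 + ‖u‖ ^ 2))) ≤ ‖L.weierstrassSigma u‖ := by
  obtain ⟨r₁, hr₁, hnear⟩ := L.exists_norm_weierstrassSigma_ge_near_zero
  obtain ⟨Cη, hCη0, hCη⟩ := L.exists_norm_eta_le
  set r : ℝ := min r₁ 1 with hr
  have hr0 : 0 < r := lt_min hr₁ one_pos
  have hrle1 : r ≤ 1 := min_le_right _ _
  have hrr₁ : r ≤ r₁ := min_le_left _ _
  set ρ : ℝ := ‖L.ω₁‖ + ‖L.ω₂‖ with hρ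
  set R : ℝ := max ρ 1 with hR
  have hR1 : 1 ≤ R := le_max_right _ _
  have hσc : Continuous L.weierstrassSigma := L.differentiable_weierstrassSigma_holds.continuous
  -- the far set and its constant
  set Kfar : Set ℂ := {w | ‖w‖ ≤ ρ ∧ ∀ lam ∈ L.lattice, r ≤ ‖w - lam‖} with hKfar
  have hKc : IsCompact Kfar := by
    refine (isCompact_closedBall (0 : ℂ) ρ).of_isClosed_subset ?_ ?_
    · have e : Kfar = closedBall (0 : ℂ) ρ ∩ ⋂ lam ∈ (L.lattice : Set ℂ), {w : ℂ | r ≤ ‖w - lam‖} := by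
        ext w; simp [hKfar, mem_closedBall, dist_zero_right]
      rw [e]
      refine isClosed_closedBall.inter (isClosed_biInter fun lam _ => ?_)
      exact isClosed_le continuous_const (continuous_norm.comp (continuous_id.sub continuous_const))
    · intro w hw; simpa [mem_closedBall, dist_zero_right] using hw.1
  have hc₁ : ∃ c₁ : ℝ, 0 < c₁ ∧ ∀ w ∈ Kfar, c₁ ≤ ‖L.weierstrassSigma w‖ := by
    rcases Kfar.eq_empty_or_nonempty with he | hne
    · exact ⟨1, one_pos, fun w hw => by rw [he] at hw; exact absurd hw (Set.notMem_empty w)⟩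
    · obtain ⟨w₀, hw₀, hmin⟩ := hKc.exists_isMinOn hne (continuous_norm.comp hσc).continuousOn
      refine ⟨‖L.weierstrassSigma w₀‖, ?_, fun w hw => hmin hw⟩
      rw [norm_pos_iff]
      intro h0
      have hmem : w₀ ∈ L.lattice := (L.weierstrassSigma_eq_zero_iff_holds w₀).mp h0
      have := hw₀.2 w₀ hmem
      rw [sub_self, norm_zero] at this
      linarith
  obtain ⟨c₁, hc₁0, hc₁⟩ := hc₁
  set C : ℝ := Cη * (1 + 9 * R ^ 2) with hC
  refine ⟨min c₁ (1 / 2), lt_min hc₁0 (by norm_num), C, by positivity, r, hr0, fun u ε hε hεr hdist => ?_⟩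
  have hE : 0 < Real.exp (-(C * (1 + ‖u‖ ^ 2))) := Real.exp_pos _
  -- reduce modulo the lattice
  obtain ⟨m, n, hw⟩ := L.exists_reduce u
  set w : ℂ := u - (m * L.ω₁ + n * L.ω₂) with hwdef
  have hu : u = w + (m * L.ω₁ + n * L.ω₂) := by rw [hwdef]; ring
  have hwρ : ‖w‖ ≤ ρ := hw
  by_cases hfar : ∀ lam ∈ L.lattice, r ≤ ‖w - lam‖
  · -- far case
    have hwK : w ∈ Kfar := ⟨hwρ, hfar⟩
    have key := L.norm_weierstrassSigma_ge_of_decomp hCη0 hCη hR1 hu (hwρ.trans (le_max_left _ _))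
    have h1 : min c₁ (1 / 2) * ε ≤ ‖L.weierstrassSigma w‖ := by
      calc min c₁ (1 / 2) * ε ≤ c₁ * 1 := mul_le_mul (min_le_left _ _) (hεr.trans hrle1) hε.le hc₁0.le
        _ = c₁ := mul_one _
        _ ≤ ‖L.weierstrassSigma w‖ := hc₁ w hwK
    calc min c₁ (1 / 2) * ε * Real.exp (-(C * (1 + ‖u‖ ^ 2)))
        ≤ ‖L.weierstrassSigma w‖ * Real.exp (-(C * (1 + ‖u‖ ^ 2))) := mul_le_mul_of_nonneg_right h1 hE.le
      _ = Real.exp (-(C * (1 + ‖u‖ ^ 2))) * ‖L.weierstrassSigma w‖ := mul_comm _ _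
      _ ≤ ‖L.weierstrassSigma u‖ := key
  · -- near case: `w` is `r`-close to some `lam' ∈ Λ`
    push Not at hfar
    obtain ⟨lam', hlam', hlt⟩ := hfar
    obtain ⟨m', n', hmn'⟩ := PeriodPair.mem_lattice.mp hlam'
    set w' : ℂ := w - lam' with hw'def
    have hu' : u = w' + ((m + m' : ℤ) * L.ω₁ + (n + n' : ℤ) * L.ω₂) := by
      rw [hw'def, ← hmn', hu]; push_cast; ring
    have hw'r : ‖w'‖ ≤ r := hlt.le
    have hεw' : ε ≤ ‖w'‖ := by
      have hmem : (((m + m' : ℤ) : ℂ) * L.ω₁ + ((n + n' : ℤ) : ℂ) * L.ω₂) ∈ L.lattice :=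
        L.int_mul_add_int_mul_mem_lattice _ _
      have := hdist _ hmem
      rwa [hu', add_sub_cancel_right] at this
    have key := L.norm_weierstrassSigma_ge_of_decomp hCη0 hCη hR1 hu' (hw'r.trans (hrle1.trans hR1))
    have h1 : min c₁ (1 / 2) * ε ≤ ‖L.weierstrassSigma w'‖ := by
      calc min c₁ (1 / 2) * ε ≤ 1 / 2 * ‖w'‖ := mul_le_mul (min_le_right _ _) hεw' hε.le (by norm_num)
        _ = ‖w'‖ / 2 := by ring
        _ ≤ ‖L.weierstrassSigma w'‖ := hnear w' (hw'r.trans hrr₁)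
    calc min c₁ (1 / 2) * ε * Real.exp (-(C * (1 + ‖u‖ ^ 2)))
        ≤ ‖L.weierstrassSigma w'‖ * Real.exp (-(C * (1 + ‖u‖ ^ 2))) := mul_le_mul_of_nonneg_right h1 hE.le
      _ = Real.exp (-(C * (1 + ‖u‖ ^ 2))) * ‖L.weierstrassSigma w'‖ := mul_comm _ _
      _ ≤ ‖L.weierstrassSigma u‖ := key

end Literature.NumberTheory.Transcendental

end

noncomputable section

open Complex Filter Metric Set
open scoped PeriodPair Topology

namespace Literature.NumberTheory.Transcendental

namespace GaGmE

namespace Std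

namespace BakerDataG

variable {β γ δ : Type} [Fintype β] [Fintype γ] [Fintype δ] [DecidableEq γ]
variable (B : BakerDataG β γ δ)

/-! ### The base theta function at the points `s·v` of a general algebraic point -/

/-- Elementary: `min(a, A⁻¹) ≥ min(a, 1)/A` for `A ≥ 1`, `a ≥ 0`. [folklore] -/
theorem min_inv_ge {a A : ℝ} (ha : 0 ≤ a) (hA : 1 ≤ A) : min a 1 / A ≤ min a A⁻¹ := by
  have hA0 : 0 < A := lt_of_lt_of_le one_pos hA
  rw [le_min_iff]
  constructor
  · rw [div_le_iff₀ hA0]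
    calc min a 1 ≤ a := min_le_left _ _
      _ = a * 1 := (mul_one a).symm
      _ ≤ a * A := mul_le_mul_of_nonneg_left hA ha
  · rw [div_eq_mul_inv]
    exact mul_le_of_le_one_left (inv_nonneg.mpr hA0.le) (min_le_right _ _)

/-- **`℘(s z_b)` is bounded by the height**: `‖℘(s z_b)‖ ≤ gBound s` for a non-torsion coordinate
and `s ≥ 1` (it is a conjugate of the generator value `x(sP_b) ∈ K`). [folklore] -/
theorem norm_weierstrassP_smul_le {b : γ} (hb : B.latCo b = none) {s : ℕ} (hs : s ≠ 0) :
    ‖℘[B.L] ((s : ℂ) * B.z b)‖ ≤ B.gBound s := by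
  have h := B.norm_embedding_gK_le B.emb s (Sum.inr (Sum.inl (b, 0)))
  have e : B.gK s (Sum.inr (Sum.inl (b, 0))) = B.xsK s b := by
    simp [gK, facK, hb, hs]
  rw [e, (B.emb_xsK_ysK hb hs).1] at h
  exact h

/-- **Per-factor lower bound.** For each `E`-coordinate `b` there are `c > 0`, `C ≥ 0` with
`c·e^{−C(s+1)³} ≤ |P_{i_b(s)}(s·z_b)|` for all `s ∈ ℕ`, `i_b(s) = 2` in the origin chart (lattice
coordinate, or `s = 0`) and `0` otherwise. For a non-torsion coordinate: `℘` is large near the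
lattice while `‖℘(s z_b)‖ ≤ gBound s`, so `s z_b` keeps a distance `≫ gBound(s)⁻¹` from `Λ`, and
`σ` is bounded below away from `Λ` (`PeriodPair.exists_norm_weierstrassSigma_ge`).
[cite: BakerWustholz2007, §6.8 (p. 119: log max |f_i(sv)| ≫ −(s²+1)‖v‖²)] -/
theorem exists_univExtP_base_ge (b : γ) : ∃ c : ℝ, 0 < c ∧ ∃ C : ℝ, 0 ≤ C ∧ ∀ s : ℕ,
    c * Real.exp (-(C * ((s : ℝ) + 1) ^ 3)) ≤
      ‖B.L.univExtP (baseFin (chartChoiceAt B.L (β := β) (δ := δ) ((s : ℂ) • B.v) b)) ((s : ℂ) * B.v (iz b))‖ := by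
  have hchart : ∀ s : ℕ, chartChoiceAt B.L (β := β) (δ := δ) ((s : ℂ) • B.v) b = decide (B.latCo b ≠ none ∨ s = 0) :=
    fun s => B.chartChoiceAt_smul s b
  have cube1 : ∀ s : ℕ, (1 : ℝ) ≤ ((s : ℝ) + 1) ^ 3 := fun s => (cube_facts s).1
  rcases hb : B.latCo b with _ | mn
  · -- non-torsion coordinate
    set z : ℂ := B.z b with hz
    obtain ⟨r₀, hr₀, C₀, hC₀0, h℘⟩ := B.L.exists_weierstrassP_norm_ge_near_lattice
    obtain ⟨cσ, hcσ, Cσ, hCσ0, r₁, hr₁, hσ⟩ := B.L.exists_norm_weierstrassSigma_ge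
    set a : ℝ := min r₀ r₁ with ha
    have ha0 : 0 < a := lt_min hr₀ hr₁
    have hm0 : 0 < min a 1 := lt_min ha0 one_pos
    set c' : ℝ := cσ * (min a 1 / (1 + C₀)) with hc'
    have hc'0 : 0 < c' := by positivity
    set C' : ℝ := B.Cg + Cσ * (1 + ‖z‖ ^ 2) with hC'
    have hCg := B.Cg_nonneg
    have hC'0 : 0 ≤ C' := by positivity
    refine ⟨min 2 (c' ^ 3), lt_min two_pos (pow_pos hc'0 3), 3 * C', by positivity, fun s => ?_⟩
    have hexp1 : Real.exp (-(3 * C' * ((s : ℝ) + 1) ^ 3)) ≤ 1 := by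
      have : 0 ≤ 3 * C' * ((s : ℝ) + 1) ^ 3 := by positivity
      exact Real.exp_le_one_iff.mpr (by linarith)
    by_cases hs : s = 0
    · -- `s = 0`: origin chart, `‖P₂(0)‖ = 2`
      subst hs
      have hc : chartChoiceAt B.L (β := β) (δ := δ) (((0 : ℕ) : ℂ) • B.v) b = true := by rw [hchart]; simp
      rw [hc]
      simp only [baseFin, if_true, Nat.cast_zero, zero_mul]
      have hP20 : ‖B.L.univExtP 2 0‖ = 2 := by
        have := B.L.norm_univExtP_two_lattice 0 0
        simpa using this
      rw [hP20]
      have : min 2 (c' ^ 3) * Real.exp (-(3 * C' * (((0 : ℕ) : ℝ) + 1) ^ 3)) ≤ 2 * 1 :=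
        mul_le_mul (min_le_left _ _) hexp1 (Real.exp_nonneg _) zero_le_two
      simpa using this
    · -- `s ≥ 1`: generic chart, `P₀(sz) = σ(sz)³`
      have hc : chartChoiceAt B.L (β := β) (δ := δ) ((s : ℂ) • B.v) b = false := by rw [hchart]; simp [hb, hs]
      rw [hc]
      simp only [baseFin, Bool.false_eq_true, if_false]
      have hsz : (s : ℂ) * z ∉ B.L.lattice := B.nat_mul_z_notMem hb hs
      rw [show B.v (iz b) = z from rfl, (PeriodPair.univExtP_eq hsz).1, norm_pow]
      -- the distance of `sz` to the lattice
      set G : ℝ := B.gBound s with hG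
      have hG1 : 1 ≤ G := B.one_le_gBound s
      set A : ℝ := G + C₀ with hA
      have hA1 : 1 ≤ A := by linarith
      have hA0 : 0 < A := by linarith
      set ε : ℝ := min a A⁻¹ with hε
      have hε0 : 0 < ε := lt_min ha0 (inv_pos.mpr hA0)
      have hεr₁ : ε ≤ r₁ := (min_le_left _ _).trans (min_le_right _ _)
      have hεr₀ : ε ≤ r₀ := (min_le_left _ _).trans (min_le_left _ _)
      have hε1 : ε ≤ 1 := (min_le_right _ _).trans (inv_le_one_of_one_le₀ hA1)
      have h℘s : ‖℘[B.L] ((s : ℂ) * z)‖ ≤ G := B.norm_weierstrassP_smul_le hb hs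
      have hdist : ∀ lam ∈ B.L.lattice, ε ≤ ‖(s : ℂ) * z - lam‖ := by
        intro lam hlam
        by_contra hlt
        push Not at hlt
        set d : ℝ := ‖(s : ℂ) * z - lam‖ with hd
        have hdpos : 0 < d := by
          rw [hd, norm_pos_iff, sub_ne_zero]
          rintro rfl; exact hsz hlam
        have h1 := h℘ lam hlam ((s : ℂ) * z) hdpos (hlt.le.trans hεr₀)
        have h2 : (d ^ 2)⁻¹ ≤ A := by rw [hA]; linarith
        have h3 : A⁻¹ ≤ d ^ 2 := by rw [inv_le_comm₀ hA0 (by positivity)]; exact h2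
        have h4 : d ^ 2 ≤ d := by
          have : d ≤ 1 := hlt.le.trans hε1
          nlinarith
        have : A⁻¹ ≤ d := h3.trans h4
        have : ε ≤ d := (min_le_right _ _).trans this
        linarith
      have hσs := hσ ((s : ℂ) * z) ε hε0 hεr₁ hdist
      -- lower bounds for the factors
      have hεge : (min a 1 / (1 + C₀)) * Real.exp (-(B.Cg * ((s : ℝ) + 1) ^ 3)) ≤ ε := by
        have h1 : min a 1 / A ≤ ε := min_inv_ge ha0.le hA1
        refine le_trans ?_ h1
        have hGe : G = Real.exp (B.Cg * ((s : ℝ) + 1) ^ 3) := (B.exp_Cg_mul_eq s).symm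
        have hAle : A ≤ G * (1 + C₀) := by rw [hA]; nlinarith
        calc min a 1 / (1 + C₀) * Real.exp (-(B.Cg * ((s : ℝ) + 1) ^ 3))
            = min a 1 / (G * (1 + C₀)) := by
              rw [Real.exp_neg, ← hGe]; field_simp
          _ ≤ min a 1 / A := div_le_div_of_nonneg_left hm0.le hA0 hAle
      have hexpge : Real.exp (-(Cσ * (1 + ‖z‖ ^ 2) * ((s : ℝ) + 1) ^ 3)) ≤
          Real.exp (-(Cσ * (1 + ‖(s : ℂ) * z‖ ^ 2))) := by
        refine Real.exp_le_exp.mpr (neg_le_neg ?_)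
        rw [norm_mul, Complex.norm_natCast, mul_assoc]
        refine mul_le_mul_of_nonneg_left ?_ hCσ0
        have hs0 : (0 : ℝ) ≤ s := Nat.cast_nonneg s
        have c3 := (cube_facts s).2.2.1
        nlinarith [sq_nonneg ((s : ℝ) * ‖z‖), sq_nonneg ‖z‖, norm_nonneg z, cube1 s,
          mul_nonneg (sq_nonneg ‖z‖) (sub_nonneg.mpr c3)]
      have hσge : c' * Real.exp (-(C' * ((s : ℝ) + 1) ^ 3)) ≤ ‖B.L.weierstrassSigma ((s : ℂ) * z)‖ := by
        refine le_trans ?_ hσs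
        have e : c' * Real.exp (-(C' * ((s : ℝ) + 1) ^ 3)) =
            cσ * ((min a 1 / (1 + C₀)) * Real.exp (-(B.Cg * ((s : ℝ) + 1) ^ 3))) *
              Real.exp (-(Cσ * (1 + ‖z‖ ^ 2) * ((s : ℝ) + 1) ^ 3)) := by
          rw [hc', hC', show -((B.Cg + Cσ * (1 + ‖z‖ ^ 2)) * ((s : ℝ) + 1) ^ 3) =
            -(B.Cg * ((s : ℝ) + 1) ^ 3) + -(Cσ * (1 + ‖z‖ ^ 2) * ((s : ℝ) + 1) ^ 3) by ring, Real.exp_add]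
          ring
        rw [e]
        exact mul_le_mul (mul_le_mul_of_nonneg_left hεge hcσ.le) hexpge (Real.exp_nonneg _) (by positivity)
      -- cube
      have hbase0 : 0 ≤ c' * Real.exp (-(C' * ((s : ℝ) + 1) ^ 3)) := by positivity
      calc min 2 (c' ^ 3) * Real.exp (-(3 * C' * ((s : ℝ) + 1) ^ 3))
          ≤ c' ^ 3 * Real.exp (-(3 * C' * ((s : ℝ) + 1) ^ 3)) :=
            mul_le_mul_of_nonneg_right (min_le_right _ _) (Real.exp_nonneg _)
        _ = (c' * Real.exp (-(C' * ((s : ℝ) + 1) ^ 3))) ^ 3 := by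
            have e3 : Real.exp (-(3 * C' * ((s : ℝ) + 1) ^ 3)) = Real.exp (-(C' * ((s : ℝ) + 1) ^ 3)) ^ 3 := by
              rw [← Real.exp_nat_mul]; congr 1; push_cast; ring
            rw [e3]; ring
        _ ≤ ‖B.L.weierstrassSigma ((s : ℂ) * z)‖ ^ 3 := pow_le_pow_left₀ hbase0 hσge 3
  · -- lattice coordinate: `‖P₂(sλ)‖ = 2 e^{3 s² Re(η(λ)λ/2)}`
    set X₀ : ℂ := ((mn.1 : ℂ) * B.L.η₁ + (mn.2 : ℂ) * B.L.η₂) * (((mn.1 : ℂ) * B.L.ω₁ + (mn.2 : ℂ) * B.L.ω₂) / 2)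
      with hX₀
    refine ⟨2, two_pos, 3 * ‖X₀‖, by positivity, fun s => ?_⟩
    have hc : chartChoiceAt B.L (β := β) (δ := δ) ((s : ℂ) • B.v) b = true := by rw [hchart]; simp [hb]
    rw [hc]
    simp only [baseFin, if_true]
    rw [show B.v (iz b) = B.z b from rfl, B.z_eq_of_some hb,
      show (s : ℂ) * ((mn.1 : ℂ) * B.L.ω₁ + (mn.2 : ℂ) * B.L.ω₂) =
        ((s * mn.1 : ℤ) : ℂ) * B.L.ω₁ + ((s * mn.2 : ℤ) : ℂ) * B.L.ω₂ by push_cast; ring,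
      B.L.norm_univExtP_two_lattice]
    have hx : (((s * mn.1 : ℤ) : ℂ) * B.L.η₁ + ((s * mn.2 : ℤ) : ℂ) * B.L.η₂) *
        ((((s * mn.1 : ℤ) : ℂ) * B.L.ω₁ + ((s * mn.2 : ℤ) : ℂ) * B.L.ω₂) / 2) = ((s : ℂ) ^ 2) * X₀ := by
      rw [hX₀]; push_cast; ring
    rw [hx, ← Real.exp_nat_mul]
    refine mul_le_mul_of_nonneg_left (Real.exp_le_exp.mpr ?_) zero_le_two
    have hre : -‖((s : ℂ) ^ 2) * X₀‖ ≤ (((s : ℂ) ^ 2) * X₀).re := by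
      have := Complex.abs_re_le_norm (((s : ℂ) ^ 2) * X₀)
      have := neg_abs_le (((s : ℂ) ^ 2) * X₀).re
      linarith
    have hn : ‖((s : ℂ) ^ 2) * X₀‖ = (s : ℝ) ^ 2 * ‖X₀‖ := by
      rw [norm_mul, norm_pow, Complex.norm_natCast]
    have c3 := (cube_facts s).2.2.1
    have hs0 : (0 : ℝ) ≤ s := Nat.cast_nonneg s
    have hsq : (s : ℝ) ^ 2 ≤ ((s : ℝ) + 1) ^ 3 := by nlinarith
    push_cast
    nlinarith [norm_nonneg X₀, mul_le_mul_of_nonneg_right hsq (norm_nonneg X₀)]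

/-- **Lower bound for the base theta function at the points `s·v`.** There are `c > 0` and
`C ≥ 0`, depending only on the data, with `c·e^{−C(s+1)³} ≤ |Θ_{J₀(c_s)}(s·v)|` for all `s ∈ ℕ`.
[cite: BakerWustholz2007, §6.8 (p. 119)] -/
theorem exists_theta_baseIdx_ge : ∃ c : ℝ, 0 < c ∧ ∃ C : ℝ, 0 ≤ C ∧ ∀ s : ℕ,
    c * Real.exp (-(C * ((s : ℝ) + 1) ^ 3)) ≤ ‖theta B.L B.κM (baseIdx (chartChoiceAt B.L ((s : ℂ) • B.v))) ((s : ℂ) • B.v)‖ := by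
  choose c hc C hC h using fun b => B.exists_univExtP_base_ge b
  refine ⟨∏ b, c b, Finset.prod_pos fun b _ => hc b, ∑ b, C b, Finset.sum_nonneg fun b _ => hC b, fun s => ?_⟩
  rw [theta_baseIdx, norm_prod]
  have e : (∏ b, c b) * Real.exp (-((∑ b, C b) * ((s : ℝ) + 1) ^ 3)) =
      ∏ b, c b * Real.exp (-(C b * ((s : ℝ) + 1) ^ 3)) := by
    rw [Finset.prod_mul_distrib, ← Real.exp_sum]
    congr 1
    rw [Finset.sum_mul, ← Finset.sum_neg_distrib]
  rw [e]
  refine Finset.prod_le_prod (fun b _ => by have := hc b; positivity) fun b _ => ?_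
  simpa [Pi.smul_apply, smul_eq_mul] using h b s

end BakerDataG

end Std

end GaGmE

end Literature.NumberTheory.Transcendental

end
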